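import Mathlib
import Summits.ValiantsHypothesis.ValiantsHypothesis.Theses.RigidityForcesSymmetry
import Summits.ValiantsHypothesis.ValiantsHypothesis.Theorems.BorderApolarityToricWitnessObstructionQPStubTorusBound
import Literature.Computability.AlgebraicComplexity.PermanentVsDeterminantProofs
import Literature.Computability.AlgebraicComplexity.StandardFamiliesProofs
import Summits.ValiantsHypothesis.ValiantsHypothesis.Theorems.RigidityForcesSymmetryGrenetBoundToVH

/-!
# Strategy census for crux `RigidityForcesSymmetry.RankRigidMinimalRepr` (stmt-ValiantsHypothesis-18034):
# calibration theorems (crux-strategist, 2026-08-17)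

Kernel-checked facts used by `STRATEGY-CENSUS.md` of this crux.  Notation: `x̃ = Λ + Σ_v x_v A_v` is the
pencil of the coefficient point `x = (Λ, A)`, `R_m(per_n) = {x : det x̃ = per_n}`, the RANK STRATUM of `x` is
`{x' ∈ R_m(per_n) : rank A'_v ≤ rank A_v ∀ v}`, and "rank-rigid at `x`" is the `nhds`-clause of the crux
(the `GL_m × GL_m`-orbit of `x` is open in its rank stratum near `x`).

* `TightRankRigid` (Sub-crux A of the census' best split): for every `n ≥ 3` SOME representation of `per_n`
  of Grenet's size `2ⁿ - 1` is rank-rigid.  Intended witness: Grenet's representation itself, whose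
  rank-constrained Zariski tangent space EQUALS its trace-balanced gauge tangent space for `n = 3, …, 8`
  (exact computation mod two primes, rigorous in the "no excess" direction; files `compute/tangent_n3to6.log`,
  `compute/tangent_n3to8_kit_j025573.log` of the strategist folder, attached as evidence): dimensions `96`, `448`,
  `1920`, `7936`, `32256`, `130048` (`= 2m² − 2`), against unconstrained Zariski tangents `141, 652, 2605, 9958,
  37821, 144696`.
* `TightRankInfRigid` + `RankInfRigidToLocallyOpen` (its two provable halves: the first-order statement,
  and the rank-constrained slice lemma = the landed `stub_infRigidToLocallyOpen` run inside the smooth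
  `GL_m × GL_m`-stable stratum), with `tightRankRigid_of_inf`.
* `crux_of_target` — **(←) `TightRankRigid → GrenetLowerBound → RankRigidMinimalRepr`**: the route's own
  TARGET plus Sub-crux A give the crux (Grenet's upper bound makes a size-`2ⁿ - 1` representation minimal).
* `target_of_crux` — **(→) `RankRigidityForcesTorus → RankRigidMinimalRepr → GrenetLowerBound`** by the PROVED
  `TorusBound` (`BorderApolarityToricWitnessObstructionQP.stub_torusBound`); this is the route's `closes` minus
  its last line.
* `crux_iff_target` — modulo the provable support `RankRigidityForcesTorus` (stmt-18035) and the provable,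
  numerically certified `TightRankRigid`, **the crux is literally the route's target `GrenetLowerBound`**
  ("Grenet is exactly optimal infinitely often").  Every line / strengthening / split of the crux must
  therefore prove `2ⁿ - 1 ≤ dc(per_n)` for infinitely many `n`; the deformation-theoretic phrasing has no
  residual content once `TightRankRigid` is a theorem (parallel to the sibling calibration
  `RigidMinimalRepsMinimalRepTorusSymmetric.minimalRepTorusSymmetric_iff_grenetLowerEventually`).
[cite: Grenet2011, Thm. 1] [cite: LandsbergRessayre2017, Thm. 2.8, Question 2.2]
-/

namespace Summit.ValiantsHypothesis.ValiantsHypothesis.Cruxes.RankRigidMinimalRepr.Census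

open Literature.Computability.AlgebraicComplexity
open Summit.ValiantsHypothesis.ValiantsHypothesis.Theses.RigidityForcesSymmetry

set_option linter.dupNamespace false

/-- **Sub-crux A — `TightRankRigid`.** For every `n ≥ 3` there is an affine determinantal representation
`(Λ, A)` of `per_n` of size `2ⁿ - 1` whose `GL × GL`-orbit is open inside its rank stratum near `(Λ, A)`
(the `nhds`-clause of the crux, verbatim).  Intended witness: Grenet's representation. [cite: Grenet2011, Thm. 1] -/
def TightRankRigid : Prop :=
  ∀ n : ℕ, 3 ≤ n → ∃ (Λ : Matrix (Fin (2 ^ n - 1)) (Fin (2 ^ n - 1)) ℂ)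
      (A : Fin n × Fin n → Matrix (Fin (2 ^ n - 1)) (Fin (2 ^ n - 1)) ℂ),
    (Λ.map MvPolynomial.C + ∑ v, (MvPolynomial.X v : MvPolynomial (Fin n × Fin n) ℂ) • (A v).map MvPolynomial.C).det
        = perPoly (Fin n) ℂ ∧
    ∃ U ∈ nhds (Λ, A), ∀ p ∈ U,
      (p.1.map MvPolynomial.C + ∑ v, (MvPolynomial.X v : MvPolynomial (Fin n × Fin n) ℂ) • (p.2 v).map MvPolynomial.C).det
          = perPoly (Fin n) ℂ →
      (∀ v, (p.2 v).rank ≤ (A v).rank) →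
      ∃ g h : GL (Fin (2 ^ n - 1)) ℂ,
        p.1 = (g : Matrix _ _ ℂ) * Λ * ((h⁻¹ : GL (Fin (2 ^ n - 1)) ℂ) : Matrix _ _ ℂ) ∧
        ∀ v, p.2 v = (g : Matrix _ _ ℂ) * A v * ((h⁻¹ : GL (Fin (2 ^ n - 1)) ℂ) : Matrix _ _ ℂ)

/-- **Sub-crux A1 — `TightRankInfRigid`** (first-order half of A): for every `n ≥ 3` some size-`2ⁿ - 1`
representation `(Λ, A)` of `per_n` is RANK-INFINITESIMALLY RIGID: every direction `(Λ', A')` that is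
Zariski-tangent to `{det = per_n}` (`tr(adj x̃ · x̃') = 0`, Jacobi) and tangent to the rank stratum
(`A'_v (ker A_v) ⊆ im A_v` for every `v`) is a gauge direction `(PΛ - ΛQ, (PA_v - A_vQ)_v)`.
Verified for Grenet's representation, `n = 3, …, 8` (strategist computation + kit job j025573, 2026-08-17).
[cite: Grenet2011, Thm. 1] -/
def TightRankInfRigid : Prop :=
  ∀ n : ℕ, 3 ≤ n → ∃ (Λ : Matrix (Fin (2 ^ n - 1)) (Fin (2 ^ n - 1)) ℂ)
      (A : Fin n × Fin n → Matrix (Fin (2 ^ n - 1)) (Fin (2 ^ n - 1)) ℂ),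
    (Λ.map MvPolynomial.C + ∑ v, (MvPolynomial.X v : MvPolynomial (Fin n × Fin n) ℂ) • (A v).map MvPolynomial.C).det
        = perPoly (Fin n) ℂ ∧
    ∀ (Λ' : Matrix (Fin (2 ^ n - 1)) (Fin (2 ^ n - 1)) ℂ)
      (A' : Fin n × Fin n → Matrix (Fin (2 ^ n - 1)) (Fin (2 ^ n - 1)) ℂ),
      ((Λ.map MvPolynomial.C + ∑ v, (MvPolynomial.X v : MvPolynomial (Fin n × Fin n) ℂ) • (A v).map MvPolynomial.C).adjugate
          * (Λ'.map MvPolynomial.C + ∑ v, (MvPolynomial.X v : MvPolynomial (Fin n × Fin n) ℂ) • (A' v).map MvPolynomial.C)).trace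
        = (0 : MvPolynomial (Fin n × Fin n) ℂ) →
      (∀ v w, (A v).mulVec w = 0 → ∃ u, (A' v).mulVec w = (A v).mulVec u) →
      ∃ P Q : Matrix (Fin (2 ^ n - 1)) (Fin (2 ^ n - 1)) ℂ, Λ' = P * Λ - Λ * Q ∧ ∀ v, A' v = P * A v - A v * Q

/-- **Sub-crux A2 — `RankInfRigidToLocallyOpen`** (the rank-constrained slice lemma): for any finite variable
type, any `f ≠ 0` and any pencil point `(Λ, A)` with `det = f`, rank-infinitesimal rigidity implies that the
`GL × GL`-orbit is open in the rank stratum of `{det = f}` near `(Λ, A)`.  (The landed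
`RigidityForcesSymmetryRigidMinimalRepr.stub_infRigidToLocallyOpen` is the unconstrained case; the same
slice argument runs inside the smooth, gauge-stable manifold `{rank A'_v = rank A_v ∀ v}`, which near
`(Λ, A)` equals the stratum by semicontinuity of rank.) [folklore] -/
def RankInfRigidToLocallyOpen : Prop :=
  ∀ (ι : Type) [Fintype ι] (m : ℕ) (f : MvPolynomial ι ℂ) (Λ : Matrix (Fin m) (Fin m) ℂ) (A : ι → Matrix (Fin m) (Fin m) ℂ),
    f ≠ 0 →
    (Λ.map MvPolynomial.C + ∑ v, (MvPolynomial.X v : MvPolynomial ι ℂ) • (A v).map MvPolynomial.C).det = f →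
    (∀ (Λ' : Matrix (Fin m) (Fin m) ℂ) (A' : ι → Matrix (Fin m) (Fin m) ℂ),
      ((Λ.map MvPolynomial.C + ∑ v, (MvPolynomial.X v : MvPolynomial ι ℂ) • (A v).map MvPolynomial.C).adjugate
          * (Λ'.map MvPolynomial.C + ∑ v, (MvPolynomial.X v : MvPolynomial ι ℂ) • (A' v).map MvPolynomial.C)).trace
        = (0 : MvPolynomial ι ℂ) →
      (∀ v w, (A v).mulVec w = 0 → ∃ u, (A' v).mulVec w = (A v).mulVec u) →
      ∃ P Q : Matrix (Fin m) (Fin m) ℂ, Λ' = P * Λ - Λ * Q ∧ ∀ v, A' v = P * A v - A v * Q) →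
    ∃ U ∈ nhds (Λ, A), ∀ p ∈ U,
      (p.1.map MvPolynomial.C + ∑ v, (MvPolynomial.X v : MvPolynomial ι ℂ) • (p.2 v).map MvPolynomial.C).det = f →
      (∀ v, (p.2 v).rank ≤ (A v).rank) →
      ∃ g h : GL (Fin m) ℂ,
        p.1 = (g : Matrix (Fin m) (Fin m) ℂ) * Λ * ((h⁻¹ : GL (Fin m) ℂ) : Matrix (Fin m) (Fin m) ℂ) ∧
        ∀ v, p.2 v = (g : Matrix (Fin m) (Fin m) ℂ) * A v * ((h⁻¹ : GL (Fin m) ℂ) : Matrix (Fin m) (Fin m) ℂ)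

/-- A1 + A2 ⇒ A (pure logic; `per_n ≠ 0`). [folklore] -/
theorem tightRankRigid_of_inf (hL : RankInfRigidToLocallyOpen) (hI : TightRankInfRigid) : TightRankRigid := by
  intro n hn
  obtain ⟨Λ, A, hdet, hrig⟩ := hI n hn
  exact ⟨Λ, A, hdet, hL (Fin n × Fin n) (2 ^ n - 1) (perPoly (Fin n) ℂ) Λ A (perPoly_ne_zero (Fin n) ℂ) hdet hrig⟩

/-- **(←) target + Sub-crux A ⇒ crux.**  If Grenet's bound is attained infinitely often, then at each such
`n ≥ 3` a size-`2ⁿ - 1` rank-rigid representation is MINIMAL (Grenet's upper bound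
`determinantalComplexity_perPoly_le_holds`), which is the crux. [cite: Grenet2011, Thm. 1] -/
theorem crux_of_target (hT : TightRankRigid) (hG : GrenetLowerBound) : RankRigidMinimalRepr := by
  intro n₀
  obtain ⟨n, hn, hlow⟩ := hG (max n₀ 3)
  have h3 : 3 ≤ n := le_trans (le_max_right n₀ 3) hn
  have hup : determinantalComplexity (perPoly (Fin n) ℂ) ≤ 2 ^ n - 1 :=
    determinantalComplexity_perPoly_le_holds ℂ n (by omega)
  obtain ⟨Λ, A, hdet, hU⟩ := hT n h3
  exact ⟨n, le_trans (le_max_left n₀ 3) hn, 2 ^ n - 1, Λ, A, (le_antisymm hup hlow).symm, hdet, hU⟩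

/-- **(→) crux ⇒ target**, through the provable support `RankRigidityForcesTorus` (stmt-18035) and the PROVED
`TorusBound` (`BorderApolarityToricWitnessObstructionQP.stub_torusBound`): the route's `closes` minus its
last line. [cite: LandsbergRessayre2017, Thm. 2.8] -/
theorem target_of_crux (h₂ : RankRigidityForcesTorus) (h : RankRigidMinimalRepr) : GrenetLowerBound := by
  intro n₀
  obtain ⟨n, hn, m, Λ, A, hm, hdet, hU⟩ := h (max n₀ 3)
  have h3 : 3 ≤ n := le_trans (le_max_right n₀ 3) hn
  refine ⟨n, le_trans (le_max_left n₀ 3) hn, ?_⟩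
  have hb := Theorems.BorderApolarityToricWitnessObstructionQP.stub_torusBound n h3 m _
    (h₂ n h3 m Λ A hdet hU)
  rw [hm] at hb
  exact hb

/-- **Calibration.** Modulo the two provable statements `RankRigidityForcesTorus` (support, stmt-18035) and
`TightRankRigid` (Sub-crux A; first-order part certified for `n ≤ 8`), the crux `RankRigidMinimalRepr`
IS the route's target `GrenetLowerBound`. [cite: Grenet2011, Thm. 1] [cite: LandsbergRessayre2017, Thm. 2.8] -/
theorem crux_iff_target (hT : TightRankRigid) (h₂ : RankRigidityForcesTorus) :
    RankRigidMinimalRepr ↔ GrenetLowerBound :=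
  ⟨target_of_crux h₂, crux_of_target hT⟩

/-- The crux is at least summit-strength: with the provable support it implies `ValiantsHypothesis`
(tree theorem `GrenetBoundToVH_proof`). [folklore] -/
theorem summit_of_crux (h₂ : RankRigidityForcesTorus) (h : RankRigidMinimalRepr) : ValiantsHypothesis :=
  closes h h₂ Theorems.BorderApolarityToricWitnessObstructionQP.stub_torusBound
    Theorems.RigidityForcesSymmetryGrenetBoundToVH.GrenetBoundToVH_proof

end Summit.ValiantsHypothesis.ValiantsHypothesis.Cruxes.RankRigidMinimalRepr.Census
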